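/-
Copyright (c) 2026 the pub-hodgecm-mathlib formalisation cell (harness21).  Prover seat hodgecm-mathlib-K2E3-p24 (g0), HCML Track B «K2-LIT» ∕ h413
(`stmt-HodgeConjecture-24833`), line `K2_E3_EllipticInputs`, line «SC′-IRR-lev» (leaf (S-C′-irr) `sig_K2E3GL3TwoBlockInducedIrreducible`; lead-designate
K2E3-p24 (g0), dealer D77∕D79), brick GEN-COUNT (ASM §1, verdict-independent): «a representation with at most one Whittaker functional cannot have two
ψ-generic layers».  2026-09-04.
-/
import Literature.NumberTheory.Automorphic.WhittakerTwistedJacquet   -- ★ `twistedJacquetMap_injective` (left exactness of `J_ψ`), `whittakerFunctionalsEquivDual` (`Hom_U(π,ψ) ≃ J_ψ(π)^*`), `IsGeneric`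
import HarnessLib

/-!
# K2_E3 road (h413), line «SC′-IRR-lev», brick GEN-COUNT — two `ψ`-generic layers force two independent Whittaker functionals

Cell `pub/hodgecm-mathlib` (D-0151), Track B, seat K2E3-p24 (g0).  `--supports stmt-HodgeConjecture-24833 --as helper`; THEOREMS ONLY (no definition ∕ instance ∕ notation ∕
named fact ∕ `sorry`); never imports `Cruxes/…/Lines`.  COUNT-NEUTRAL.

For representations `π₁ →(i) π₂ →(p) π₃` of `GL_n(F)` with `i` injective, `p` surjective and `p ∘ i = 0` (a layer `π₁` and a layer `π₃` of `π₂`, not necessarily a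
short exact sequence), `π₂` smooth and `ψ` continuous:

* `comp_mem_whittakerFunctionals` — pull-back: `Λ₃ ∘ p ∈ Hom_U(π₂, ψ_U)` for `Λ₃ ∈ Hom_U(π₃, ψ_U)`; `isGeneric_of_surjective`.
* `exists_whittakerFunctional_comp_eq_of_injective` — **extension**: every `Λ₁ ∈ Hom_U(π₁, ψ_U)` is `Λ ∘ i` for some `Λ ∈ Hom_U(π₂, ψ_U)` (dual of the LEFT EXACTNESS
  of the twisted Jacquet functor, ★ `twistedJacquetMap_injective`, through ★ `whittakerFunctionalsEquivDual`); `isGeneric_of_injective`.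
* **`two_layers_not_generic_of_rank_le_one`** — if `rank Hom_U(π₂, ψ_U) ≤ 1` then `π₁` and `π₃` are NOT BOTH `ψ`-generic (an extension `Λ_A` of `Λ₁ ≠ 0` and the
  pull-back `Λ_B = Λ₃ ∘ p ≠ 0` would be proportional, but `Λ_B ∘ i = 0 ≠ Λ₁ = Λ_A ∘ i`).

This is the counting step «`dim Wh(π) ≤ 1` ⇒ at most one generic constituent» of Bernstein–Zelevinsky's proof of the irreducibility criterion and of Rodier's
heredity count (BZ 1977, §4.7: `π^{(n)} = Σ_ω ω^{(n)}` by exactness of the top derivative), in the form consumed by the ASM of line «SC′-IRR-lev» (length-2 flags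
`ω₁ ↪ π ↠ ω′`) and by the H-layer of leaf (nsc-S-A′).  [BernsteinZelevinsky1977, Prop. 1.9 (a), §4.7] [Bump1997, Prop. 4.4.3–4.4.4] [Rodier1973, Thm. p. 428]
HONEST LABEL: HC_CM is proved only modulo the 7 printed citations (2 remaining named inputs: hLiu418 = stmt-HodgeConjecture-24832, h413 = stmt-HodgeConjecture-24833)
until rung 0 closes; count-neutral helper.

## Mathlib ∕ tree search
Tree: ★ `whittakerFunctionals`, `mem_whittakerFunctionals_iff`, `IsGeneric`, `isGeneric_iff`, `twistedJacquet`, `twistedJacquetMap`, `twistedJacquetMap_mk`,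
`twistedJacquetMap_injective`, `whittakerFunctionalsEquivDual`, `whittakerFunctionalsEquivDual_apply_mk`, `whittakerFunctionalsEquivDual_symm_apply`,
`lift_rank_whittakerFunctionals_le_of_injective` (rank form only — the EXTENSION form is typed here).  Mathlib: `Representation.IntertwiningMap.isIntertwining`,
`LinearMap.dualMap_surjective_of_injective`, `rank_le_one_iff`.  Dedup: `rg "comp_mem_whittakerFunctionals|two_layers|isGeneric_of_surjective"` — no hits.

## References
* [BernsteinZelevinsky1977] I. N. Bernstein, A. V. Zelevinsky, *Induced representations of reductive `p`-adic groups I*, Ann. Sci. ÉNS 10 (1977), Prop. 1.9 (a), §4.7.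
* [Bump1997] D. Bump, *Automorphic Forms and Representations* (1997), Prop. 4.4.3–4.4.4.
* [Rodier1973] F. Rodier, *Whittaker models for admissible representations of reductive p-adic split groups*, PSPM 26 (1973), 425–430.
-/

set_option autoImplicit false
set_option linter.dupNamespace false

noncomputable section

open Literature.NumberTheory.Automorphic

namespace Summit.HodgeConjecture.HodgeConjecture.Cruxes.H413.K2E3GenericConstituentCount

universe v₁ v₂ v₃

section Algebra

variable {R : Type*} [CommRing R] {n : ℕ}
  {V₁ : Type v₁} {V₂ : Type v₂} {V₃ : Type v₃} [AddCommGroup V₁] [Module ℂ V₁] [AddCommGroup V₂] [Module ℂ V₂] [AddCommGroup V₃] [Module ℂ V₃]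
  {π₁ : Representation ℂ (GL (Fin n) R) V₁} {π₂ : Representation ℂ (GL (Fin n) R) V₂} {π₃ : Representation ℂ (GL (Fin n) R) V₃}
  (ψ : AddChar R Circle)

/-- **Pull-back of a Whittaker functional along an intertwining map**: `Λ₃ ∘ p ∈ Hom_U(π₂, ψ_U)` for `Λ₃ ∈ Hom_U(π₃, ψ_U)`. [cite: BernsteinZelevinsky1977, Prop. 1.9 (a)] -/
theorem comp_mem_whittakerFunctionals (p : π₂.IntertwiningMap π₃) {Λ₃ : Module.Dual ℂ V₃} (hΛ₃ : Λ₃ ∈ whittakerFunctionals π₃ ψ) :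
    Λ₃ ∘ₗ p.toLinearMap ∈ whittakerFunctionals π₂ ψ := by
  rw [mem_whittakerFunctionals_iff] at hΛ₃ ⊢
  intro u v
  rw [LinearMap.comp_apply, LinearMap.comp_apply, Representation.IntertwiningMap.toLinearMap_apply, Representation.IntertwiningMap.toLinearMap_apply,
    p.isIntertwining, hΛ₃]

/-- **A representation with a `ψ`-generic quotient is `ψ`-generic** (`p` surjective). [cite: BernsteinZelevinsky1977, Prop. 1.9 (a)] -/
theorem isGeneric_of_surjective (p : π₂.IntertwiningMap π₃) (hp : Function.Surjective p) (h₃ : IsGeneric π₃ ψ) : IsGeneric π₂ ψ := by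
  rw [isGeneric_iff] at h₃ ⊢
  obtain ⟨Λ₃, hΛ₃, hne⟩ := h₃
  refine ⟨Λ₃ ∘ₗ p.toLinearMap, comp_mem_whittakerFunctionals ψ p hΛ₃, fun h0 => hne (LinearMap.ext fun w => ?_)⟩
  obtain ⟨v, rfl⟩ := hp w
  have := LinearMap.congr_fun h0 v
  simpa using this

end Algebra

section LocalField

variable {F : Type*} [Field F] [ValuativeRel F] [TopologicalSpace F] [IsNonarchimedeanLocalField F] {n : ℕ}
  {V₁ : Type v₁} {V₂ : Type v₂} {V₃ : Type v₃} [AddCommGroup V₁] [Module ℂ V₁] [AddCommGroup V₂] [Module ℂ V₂] [AddCommGroup V₃] [Module ℂ V₃]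
  {π₁ : Representation ℂ (GL (Fin n) F) V₁} {π₂ : Representation ℂ (GL (Fin n) F) V₂} {π₃ : Representation ℂ (GL (Fin n) F) V₃}
  (ψ : AddChar F Circle)

/-- **Extension of Whittaker functionals along an injection into a smooth representation**: for `i : π₁ ↪ π₂` (`π₂` smooth, `ψ` continuous) every
`Λ₁ ∈ Hom_U(π₁, ψ_U)` is the restriction `Λ ∘ i` of some `Λ ∈ Hom_U(π₂, ψ_U)` — the dual of the injectivity `J_ψ(π₁) ↪ J_ψ(π₂)` (★ `twistedJacquetMap_injective`).
[cite: BernsteinZelevinsky1977, Prop. 1.9 (a)] [cite: Bump1997, Prop. 4.4.3–4.4.4] -/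
theorem exists_whittakerFunctional_comp_eq_of_injective (h₂ : π₂.IsSmooth) (hψ : Continuous ψ) (i : π₁.IntertwiningMap π₂) (hi : Function.Injective i)
    {Λ₁ : Module.Dual ℂ V₁} (hΛ₁ : Λ₁ ∈ whittakerFunctionals π₁ ψ) :
    ∃ Λ ∈ whittakerFunctionals π₂ ψ, Λ ∘ₗ i.toLinearMap = Λ₁ := by
  have hinj := twistedJacquetMap_injective ψ h₂ hψ i hi
  obtain ⟨μ₂, hμ₂⟩ := (twistedJacquetMap ψ i).dualMap_surjective_of_injective hinj (whittakerFunctionalsEquivDual π₁ ψ ⟨Λ₁, hΛ₁⟩)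
  refine ⟨((whittakerFunctionalsEquivDual π₂ ψ).symm μ₂ : ↥(whittakerFunctionals π₂ ψ)), ((whittakerFunctionalsEquivDual π₂ ψ).symm μ₂).2, ?_⟩
  ext v
  rw [LinearMap.comp_apply, Representation.IntertwiningMap.toLinearMap_apply, whittakerFunctionalsEquivDual_symm_apply, ← twistedJacquetMap_mk,
    ← LinearMap.dualMap_apply, hμ₂, whittakerFunctionalsEquivDual_apply_mk]

/-- **A smooth representation with a `ψ`-generic subrepresentation is `ψ`-generic** (`i` injective). [cite: BernsteinZelevinsky1977, Prop. 1.9 (a)] -/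
theorem isGeneric_of_injective (h₂ : π₂.IsSmooth) (hψ : Continuous ψ) (i : π₁.IntertwiningMap π₂) (hi : Function.Injective i) (h₁ : IsGeneric π₁ ψ) :
    IsGeneric π₂ ψ := by
  rw [isGeneric_iff] at h₁ ⊢
  obtain ⟨Λ₁, hΛ₁, hne⟩ := h₁
  obtain ⟨Λ, hΛ, hcomp⟩ := exists_whittakerFunctional_comp_eq_of_injective ψ h₂ hψ i hi hΛ₁
  refine ⟨Λ, hΛ, fun h0 => hne ?_⟩
  rw [← hcomp, h0, LinearMap.zero_comp]

/-- **GEN-COUNT: two `ψ`-generic layers are impossible under multiplicity `≤ 1`.**  Let `i : π₁ → π₂` be injective, `p : π₂ → π₃` surjective with `p ∘ i = 0`,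
`π₂` smooth, `ψ` continuous and `rank Hom_U(π₂, ψ_U) ≤ 1`.  Then `π₁` and `π₃` are not both `ψ`-generic.  (Extend `Λ₁ ≠ 0` to `Λ_A` on `π₂`; pull back `Λ₃ ≠ 0`
to `Λ_B = Λ₃ ∘ p ≠ 0`; both are multiples of one `Λ₀`; `Λ_B ∘ i = 0` and `Λ_A ∘ i = Λ₁ ≠ 0` force the coefficient of `Λ_B` to vanish.)  In particular a representation
with `dim Wh ≤ 1` has at most one `ψ`-generic constituent in any flag. [cite: BernsteinZelevinsky1977, §4.7] [cite: Bump1997, Prop. 4.4.3–4.4.4] -/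
theorem two_layers_not_generic_of_rank_le_one (h₂ : π₂.IsSmooth) (hψ : Continuous ψ) (i : π₁.IntertwiningMap π₂) (hi : Function.Injective i)
    (p : π₂.IntertwiningMap π₃) (hp : Function.Surjective p) (hpi : ∀ v, p (i v) = 0)
    (hrank : Module.rank ℂ ↥(whittakerFunctionals π₂ ψ) ≤ 1) (h₁ : IsGeneric π₁ ψ) (h₃ : IsGeneric π₃ ψ) : False := by
  rw [isGeneric_iff] at h₁ h₃
  obtain ⟨Λ₁, hΛ₁, hne₁⟩ := h₁
  obtain ⟨Λ₃, hΛ₃, hne₃⟩ := h₃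
  obtain ⟨ΛA, hΛA, hA⟩ := exists_whittakerFunctional_comp_eq_of_injective ψ h₂ hψ i hi hΛ₁
  have hΛB : Λ₃ ∘ₗ p.toLinearMap ∈ whittakerFunctionals π₂ ψ := comp_mem_whittakerFunctionals ψ p hΛ₃
  -- `Λ_B ≠ 0` (as `p` is onto) and `Λ_B ∘ i = 0`
  have hBne : Λ₃ ∘ₗ p.toLinearMap ≠ 0 := by
    intro h0
    refine hne₃ (LinearMap.ext fun w => ?_)
    obtain ⟨v, rfl⟩ := hp w
    have := LinearMap.congr_fun h0 v
    simpa using this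
  have hBi : (Λ₃ ∘ₗ p.toLinearMap) ∘ₗ i.toLinearMap = 0 := by
    ext v
    simp only [LinearMap.comp_apply, Representation.IntertwiningMap.toLinearMap_apply, hpi v, map_zero, LinearMap.zero_apply]
  -- both are multiples of one generator `Λ₀`
  obtain ⟨Λ₀, hΛ₀⟩ := rank_le_one_iff.1 hrank
  obtain ⟨a, ha⟩ := hΛ₀ ⟨ΛA, hΛA⟩
  obtain ⟨b, hb⟩ := hΛ₀ ⟨Λ₃ ∘ₗ p.toLinearMap, hΛB⟩
  have ha' : a • (Λ₀ : Module.Dual ℂ V₂) = ΛA := by simpa using congrArg Subtype.val ha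
  have hb' : b • (Λ₀ : Module.Dual ℂ V₂) = Λ₃ ∘ₗ p.toLinearMap := by simpa using congrArg Subtype.val hb
  -- restrict to `π₁`
  have hA0 : a • ((Λ₀ : Module.Dual ℂ V₂) ∘ₗ i.toLinearMap) = Λ₁ := by rw [← hA, ← ha', LinearMap.smul_comp]
  have hB0 : b • ((Λ₀ : Module.Dual ℂ V₂) ∘ₗ i.toLinearMap) = 0 := by rw [← hBi, ← hb', LinearMap.smul_comp]
  have h0i : (Λ₀ : Module.Dual ℂ V₂) ∘ₗ i.toLinearMap ≠ 0 := by
    intro h0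
    rw [h0, smul_zero] at hA0
    exact hne₁ hA0.symm
  have hb0 : b = 0 := by
    rcases smul_eq_zero.1 hB0 with h | h
    · exact h
    · exact absurd h h0i
  rw [hb0, zero_smul] at hb'
  exact hBne hb'.symm

end LocalField

end Summit.HodgeConjecture.HodgeConjecture.Cruxes.H413.K2E3GenericConstituentCount

end
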